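import Mathlib.RingTheory.RootsOfUnity.AlgebraicallyClosed
import Literature.NumberTheory.GaloisRepresentations.LocalGaloisGroup
import Mathlib.Analysis.Normed.Unbundled.SpectralNorm
import Mathlib.Topology.Algebra.Valued.NormedValued
import Mathlib.RingTheory.Henselian
import HarnessLib

/-!
# Discharges of named facts in `LocalGaloisGroup.lean` (trunk GalRep, item C4)

D-0014 keeps `Literature/` sorry-free by stating cited results as named facts `def X : Prop`.
This sibling file proves those facts of
`Literature.NumberTheory.GaloisRepresentations.LocalGaloisGroup` that follow from the
definitions alone, as `theorem X_holds : X`; users holding `(h : X)` are fed `X_holds`.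

* `IsFrobPow.mul_holds : IsFrobPow.mul` — Frobenius powers multiply and their exponents add
  (Tate, Corvallis 1979, §1.4, (1.4.1)–(1.4.4): `σ ↦ ‖σ‖`, resp. the exponent of Frobenius, is a
  homomorphism on `W_F`).
* `IsNonarchimedeanLocalField.smul_absMaximalIdeal_holds`, `under_absMaximalIdeal_holds`,
  `card_quotient_under_absMaximalIdeal_holds`, and the consequences
  `decompositionSubgroup_absMaximalIdeal_eq_top_holds`, `absInertia_normal_holds`,
  `isClosed_absInertia_holds` (via `absIntegers.isClosed_inertia_holds`), `isAbsArithFrob_iff_holds`,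
  `isFrobPow_one_iff_isAbsArithFrob_holds`, `IsAbsArithFrob.isFrobPow_holds`,
  `IsFrobPow.mul_inv_mem_absInertia_holds`, `IsFrobPow.inertia_mul_holds` — all by construction of
  `𝔓 = absMaximalIdeal F` as the radical of `𝓂[F] S` (Galois-stable) plus lying-over
  (`𝔓 ≠ S`, `𝔓 ∩ 𝒪[F] = 𝓂[F]`); no henselian input.
* `IsFrobPow.unique_holds : IsFrobPow.unique` — the exponent of a Frobenius power is unique
  (roots of unity of prime order `ℓ ≠ p` are distinct modulo `𝔓`), so `deg : W_F → ℤ` is well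
  defined (Tate (1.4.1)).
* `IsFrobPow.absGaloisRestrict_holds : IsFrobPow.absGaloisRestrict` — degree scaling under the
  restriction `Gal(Ē/E) → Gal(F̄/F)` (Tate, Corvallis 1979, §1.4, (1.4.5)–(1.4.6):
  `W_E = G_E ∩ W_F`, `‖w‖_E = ‖w‖_F`); see Part II of this file.

Discharged in sibling files: `absMaximalIdeal_isMaximal`, `primesOver_maximalIdeal_eq_singleton`
(henselian property of `F`; `LocalGaloisGroupHenselProofs.lean`) and `exists_isAbsArithFrob`,
`exists_isFrobPow` (Frobenius lifts; `LocalGaloisGroupFrobeniusProofs.lean`, which imports this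
file).  Still open in `LocalGaloisGroup.lean`: `absInertia_map_absGaloisRestrict_le` (finite
extensions).

## Proof of `IsFrobPow.mul`

The proof is elementary and uses *only* the two properties of `𝔓 = absMaximalIdeal F` that hold
by construction: `𝔓` is a radical ideal (it is defined as a radical) and it contains the residue
characteristic `p = ringChar 𝓀[F]` (since `p ∈ 𝓂[F]`).  Neither maximality nor Galois-stability
of `𝔓` (the henselian named facts of the parent file) is needed.

Write `q = q_F = p ^ f`.  The auxiliary relation "`PowCongr σ a b`" (kept inline below) says
`(σ • x) ^ (q ^ a) ≡ x ^ (q ^ b) (mod 𝔓)` for all `x ∈ S`, i.e. "`Frob ^ a ∘ σ = Frob ^ b`" on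
`S ⧸ 𝔓`.  Then `IsFrobPow σ n ↔ PowCongr σ 0 n` and `IsFrobPow σ (-(n+1)) ↔ PowCongr σ (n+1) 0`,
the relation is multiplicative (`PowCongr σ a b → PowCongr τ c d → PowCongr (σ * τ) (a+c) (b+d)`,
because `y ↦ y ^ q` is a ring endomorphism modulo `𝔓` in the weak form `u ≡ v → u^N ≡ v^N`), and
it can be shifted down (`PowCongr σ (a+c) (b+c) → PowCongr σ a b`) because Frobenius is injective
modulo a radical ideal containing `p`: `(u - v) ^ (p ^ n) = u ^ (p ^ n) - v ^ (p ^ n) - p·(…)`.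

## Proof of `IsFrobPow.absGaloisRestrict`

Note on the statement.  As registered, the fact carries *no* hypothesis relating the valuations of
`F` and `E` (the section variables `[FiniteDimensional F E] [ValuativeExtension F E]` of the source
file are not used by the definition, hence were not included by Lean).  The statement is
nevertheless true in this generality and is proved here as registered: a ring homomorphism between
non-archimedean local fields whose residue cardinalities satisfy `q_E = q_F ^ f` (`f ≥ 1` is forced
by `q_E > 1`) is automatically compatible with the valuations
(`Literature.NumberTheory.GaloisRepresentations.IsNonarchimedeanLocalField.valuativeExtension_of_cast_residueFieldCard_eq_zero`), because a
principal unit of `F` is an `m`-th power for every `m` prime to the residue characteristic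
(Hensel), so its image in `E` has trivial valuation (divisibility in `ℤ`) and trivial residue
(`m = q_E - 1`).

Architecture of the proof (all intermediate results are proved, nothing is assumed):

1. *Spectral description of `S_K` and `𝔓_K`* (`K` a non-archimedean local field, normed through a
   rank-one embedding `ε : ValueGroupWithZero K →*₀ ℝ≥0`, written inline with `letI`; no instance is
   declared): `a ∈ S_K = absIntegers 𝒪[K] K ↔ spectralNorm K K̄ a ≤ 1`
   (`mem_absIntegers_iff_spectralNorm_le_one`: `𝒪[K]` is integrally closed, so integrality over
   `𝒪[K]` means `minpoly K a ∈ 𝒪[K][X]`, i.e. `spectralValue (minpoly K a) ≤ 1`), and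
   `a ∈ 𝔓_K = absMaximalIdeal K ↔ spectralNorm K K̄ a < 1` for `a ∈ S_K`
   (`mem_absMaximalIdeal_iff_spectralNorm_lt_one`; recall `𝔓_K := rad (𝓂[K] S_K)`).
2. *Uniqueness of the extension of the absolute value of a complete field* (Cassels–Fröhlich,
   Ch. II §10, Theorem; Bosch–Güntzer–Remmert 3.2.4/2, in Mathlib as `spectralNorm_unique`): for the
   chosen embedding `ι = absClosureEmbedding F E : F̄ →ₐ[F] Ē` one has
   `spectralNorm E Ē (ι a) = spectralNorm F F̄ a` (`spectralNorm_absClosureEmbedding`), whence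
   `ι a ∈ S_E ↔ a ∈ S_F` and `ι a ∈ 𝔓_E ↔ a ∈ 𝔓_F`.
3. *Assembly*: `ι (res σ • y - y ^ (q_F ^ (f k))) = σ • ι y - (ι y) ^ (q_E ^ k)`
   (`absGaloisRestrict_apply_smul`, `q_E ^ k = q_F ^ (f k)`), so the congruence for `σ` on `S_E`
   pulls back to the congruence for `res σ` on `S_F`; negative exponents via `σ⁻¹`.

Mathlib search: Mathlib has `spectralNorm`, `spectralNorm_unique`,
`Valued.toNontriviallyNormedField`,
`IsNonarchimedeanLocalField` (with `CompleteSpace`, `IsAdicComplete 𝓂[K] 𝒪[K]`,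
`valueGroupWithZeroIsoInt`), `HenselianRing`, but no statement linking `ValuativeExtension` to
`IsNonarchimedeanLocalField`, no integral closure of `𝒪[K]` in `K̄`, and no automatic-continuity
result for local fields (grep `ValuativeExtension`, `spectralNorm`, `absoluteGaloisGroup`).

## References

* J. Tate, *Number theoretic background*, in: Automorphic forms, representations and
  `L`-functions (Corvallis 1977), Proc. Sympos. Pure Math. XXXIII Part 2, AMS 1979, 3–26,
  §1.4, (1.4.1)–(1.4.6).  Keys `Corvallis1979`, `TateNTB1979`.
* J.-P. Serre, *Local Fields*, GTM 67, 1979, Ch. I §8 (Frobenius on perfect residue fields),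
  Ch. II §2, Prop. 3 and Cor. 2 (integral closure of a complete d.v.r.; the unique prime above),
  Ch. II §4, Prop. 7 (Hensel).  Key `SerreLocalFields1979`.
* J. W. S. Cassels, *Global fields*, Ch. II of Cassels–Fröhlich, *Algebraic Number Theory* (1967),
  §10 "Extension of valuations", Theorem (a complete field has precisely one extension of its
  valuation to a finite extension).  Key `CasselsFrohlichANT1967`.
* S. Bosch, U. Güntzer, R. Remmert, *Non-Archimedean Analysis* (1984), 3.2.4, Theorem 2 (the form
  formalised in Mathlib as `spectralNorm_unique`).  Key `BoschGuntzerRemmert1984`.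

Design notes.
* No definition, instance, notation or attribute is introduced: the normed-field structure on a
  local field `K` attached to `ε : RankLeOneStruct K` is spelled out in each statement by the same
  four-line `letI` chain (`IsTopologicalAddGroup.rightUniformSpace`,
  `isUniformAddGroup_of_addCommGroup`, `Valuation.RankOne.ofRankLeOneStruct ε`,
  `Valued.toNontriviallyNormedField`), so that Mathlib's `CompleteSpace K` and
  `IsUltrametricDist K` instances apply verbatim.  For the comparison `F → E` the embedding of `F`
  is induced from that of `E` through `ValuativeExtension.mapValueGroupWithZero F E`, which makes
  `‖algebraMap F E k‖ = ‖k‖` hold on the nose.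
* `open scoped Valued` is deliberately *not* used in this file (nothing here needs it, and it
  would make the notation `𝒪[K]` ambiguous inside the `letI` contexts of Part II, where a
  `Valued K _` instance is in scope).
-/

noncomputable section

open scoped Pointwise NNReal WithZero
open ValuativeRel Field

namespace Literature.NumberTheory.GaloisRepresentations

namespace IsFrobPow

open GaloisRepresentations.IsNonarchimedeanLocalField

variable {F : Type*} [Field F] [ValuativeRel F] [TopologicalSpace F] [IsNonarchimedeanLocalField F]

/-- Frobenius is injective modulo a radical ideal containing the prime `p`: if
`u ^ (p ^ n) - v ^ (p ^ n) ∈ I` then `u - v ∈ I`.  (Binomial theorem modulo `p`: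
`(u - v) ^ (p ^ n) ≡ u ^ (p ^ n) - v ^ (p ^ n) (mod p)`, then radicality.)
Ref: Serre, *Local Fields*, Ch. I §8 (perfect residue fields). [folklore] -/
theorem sub_mem_of_pow_prime_pow_sub_pow_mem {R : Type*} [CommRing R] {p : ℕ} (hp : p.Prime)
    {I : Ideal R} (hI : I.IsRadical) (hpI : (p : R) ∈ I) {u v : R} {n : ℕ}
    (h : u ^ p ^ n - v ^ p ^ n ∈ I) : u - v ∈ I := by
  obtain ⟨r, hr⟩ := exists_add_pow_prime_pow_eq hp v (u - v) n
  have huv : v + (u - v) = u := by ring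
  rw [huv] at hr
  refine hI ⟨p ^ n, ?_⟩
  have key : (u - v) ^ p ^ n = u ^ p ^ n - v ^ p ^ n - p * v * (u - v) * r := by
    rw [hr]; ring
  rw [key]
  exact I.sub_mem h (I.mul_mem_right _ (I.mul_mem_right _ (I.mul_mem_right _ hpI)))

/-- The residue characteristic `p = ringChar 𝓀[F]` lies in `𝔓 = absMaximalIdeal F`
(indeed `p ∈ 𝓂[F] ⊆ 𝓂[F] S ⊆ 𝔓`).  Ref: Serre, *Local Fields*, Ch. II §1. [folklore] -/
theorem natCast_ringChar_mem_absMaximalIdeal :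
    ((ringChar 𝓀[F] : ℕ) : absIntegers 𝒪[F] F) ∈ absMaximalIdeal F := by
  have h : ((ringChar 𝓀[F] : ℕ) : 𝒪[F]) ∈ 𝓂[F] := by
    rw [← IsLocalRing.residue_eq_zero_iff, map_natCast]
    exact ringChar.Nat.cast_ringChar
  have h' := Ideal.mem_map_of_mem (algebraMap 𝒪[F] (absIntegers 𝒪[F] F)) h
  rw [map_natCast] at h'
  exact Ideal.le_radical h'

/-- Injectivity of `x ↦ x ^ (q_F ^ k)` modulo `𝔓`: `u ^ (q ^ k) ≡ v ^ (q ^ k) → u ≡ v (mod 𝔓)`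
(`𝔓` is radical and contains `p`, `q = p ^ f`).
Ref: Serre, *Local Fields*, Ch. I §8; Tate, Corvallis 1979, (1.4.1). [folklore] -/
theorem sub_mem_absMaximalIdeal_of_pow_sub_pow_mem {u v : absIntegers 𝒪[F] F} {k : ℕ}
    (h : u ^ residueFieldCard F ^ k - v ^ residueFieldCard F ^ k ∈ absMaximalIdeal F) :
    u - v ∈ absMaximalIdeal F := by
  classical
  letI := Fintype.ofFinite 𝓀[F]
  obtain ⟨n, hp, hn⟩ := FiniteField.card 𝓀[F] (ringChar 𝓀[F])
  have hq : residueFieldCard F = ringChar 𝓀[F] ^ (n : ℕ) := by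
    rw [residueFieldCard, Nat.card_eq_fintype_card, hn]
  rw [hq, ← pow_mul] at h
  exact sub_mem_of_pow_prime_pow_sub_pow_mem hp (Ideal.radical_isRadical _)
    natCast_ringChar_mem_absMaximalIdeal h

/-- Weak multiplicativity of Frobenius modulo `𝔓`: `u ≡ v → u ^ N ≡ v ^ N`. [folklore] -/
theorem pow_sub_pow_mem_absMaximalIdeal {u v : absIntegers 𝒪[F] F}
    (h : u - v ∈ absMaximalIdeal F) (N : ℕ) : u ^ N - v ^ N ∈ absMaximalIdeal F := by
  obtain ⟨c, hc⟩ := sub_dvd_pow_sub_pow u v N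
  rw [hc]
  exact Ideal.mul_mem_right _ _ h

/-- `IsFrobPow σ n` (`n : ℕ`) in "`PowCongr σ 0 n`" form:
`(σ • x) ^ (q ^ 0) ≡ x ^ (q ^ n)`. [folklore] -/
theorem powCongr_zero_iff {σ : absoluteGaloisGroup F} {n : ℕ} :
    (∀ x : absIntegers 𝒪[F] F,
      (σ • x) ^ residueFieldCard F ^ 0 - x ^ residueFieldCard F ^ n ∈ absMaximalIdeal F) ↔
    IsFrobPow σ n := by
  simp only [pow_zero, pow_one]
  exact isFrobPow_natCast_iff.symm

/-- `IsFrobPow σ (-(n+1))` in "`PowCongr σ (n + 1) 0`" form: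
`(σ • x) ^ (q ^ (n+1)) ≡ x ^ (q ^ 0)` (substitute `x ↦ σ⁻¹ • x`). [folklore] -/
theorem powCongr_succ_zero_iff {σ : absoluteGaloisGroup F} {n : ℕ} :
    (∀ x : absIntegers 𝒪[F] F,
      (σ • x) ^ residueFieldCard F ^ (n + 1) - x ^ residueFieldCard F ^ 0 ∈ absMaximalIdeal F) ↔
    IsFrobPow σ (Int.negSucc n) := by
  rw [isFrobPow_negSucc_iff]
  simp only [pow_zero, pow_one]
  constructor
  · intro h x
    have hx := h (σ⁻¹ • x)
    rw [smul_inv_smul] at hx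
    rw [← neg_sub, Ideal.neg_mem_iff]
    exact hx
  · intro h x
    have hx := h (σ • x)
    rw [inv_smul_smul] at hx
    rw [← neg_sub, Ideal.neg_mem_iff]
    exact hx

/-- Shifting down (Frobenius injectivity mod `𝔓`):
`PowCongr σ (a + c) (b + c) → PowCongr σ a b`. [folklore] -/
theorem powCongr_of_add_right {σ : absoluteGaloisGroup F} {a b c : ℕ}
    (h : ∀ x : absIntegers 𝒪[F] F,
      (σ • x) ^ residueFieldCard F ^ (a + c) - x ^ residueFieldCard F ^ (b + c) ∈
        absMaximalIdeal F) :
    ∀ x : absIntegers 𝒪[F] F,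
      (σ • x) ^ residueFieldCard F ^ a - x ^ residueFieldCard F ^ b ∈ absMaximalIdeal F := by
  intro x
  have hx := h x
  rw [pow_add, pow_mul, pow_add, pow_mul] at hx
  exact sub_mem_absMaximalIdeal_of_pow_sub_pow_mem hx

/-- Multiplicativity: `PowCongr σ a b → PowCongr τ c d → PowCongr (σ * τ) (a + c) (b + d)`
(`Frob^{a+c} σ τ = Frob^c (Frob^a σ) τ ≡ Frob^c Frob^b τ = Frob^b (Frob^c τ) ≡ Frob^{b+d}`).
Ref: Tate, Corvallis 1979, (1.4.1)–(1.4.4). [folklore] -/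
theorem powCongr_mul {σ τ : absoluteGaloisGroup F} {a b c d : ℕ}
    (hσ : ∀ x : absIntegers 𝒪[F] F,
      (σ • x) ^ residueFieldCard F ^ a - x ^ residueFieldCard F ^ b ∈ absMaximalIdeal F)
    (hτ : ∀ x : absIntegers 𝒪[F] F,
      (τ • x) ^ residueFieldCard F ^ c - x ^ residueFieldCard F ^ d ∈ absMaximalIdeal F) :
    ∀ x : absIntegers 𝒪[F] F,
      ((σ * τ) • x) ^ residueFieldCard F ^ (a + c) - x ^ residueFieldCard F ^ (b + d) ∈
        absMaximalIdeal F := by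
  intro x
  have h1 : ((σ • τ • x) ^ residueFieldCard F ^ a) ^ residueFieldCard F ^ c -
      ((τ • x) ^ residueFieldCard F ^ b) ^ residueFieldCard F ^ c ∈ absMaximalIdeal F :=
    pow_sub_pow_mem_absMaximalIdeal (hσ (τ • x)) _
  have h2 : ((τ • x) ^ residueFieldCard F ^ c) ^ residueFieldCard F ^ b -
      (x ^ residueFieldCard F ^ d) ^ residueFieldCard F ^ b ∈ absMaximalIdeal F :=
    pow_sub_pow_mem_absMaximalIdeal (hτ x) _
  have hcomm : ((τ • x) ^ residueFieldCard F ^ b) ^ residueFieldCard F ^ c =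
      ((τ • x) ^ residueFieldCard F ^ c) ^ residueFieldCard F ^ b := by
    rw [← pow_mul, ← pow_mul, mul_comm]
  rw [hcomm] at h1
  have h3 := Ideal.add_mem _ h1 h2
  rw [sub_add_sub_cancel] at h3
  rw [mul_smul, pow_add, pow_mul, pow_add, mul_comm (residueFieldCard F ^ b), pow_mul]
  exact h3

/-- Every Frobenius power `IsFrobPow σ m` is a "`PowCongr σ a b`" with `m = b - a`. [folklore] -/
theorem exists_powCongr {σ : absoluteGaloisGroup F} {m : ℤ} (hσ : IsFrobPow σ m) :
    ∃ a b : ℕ, (∀ x : absIntegers 𝒪[F] F,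
      (σ • x) ^ residueFieldCard F ^ a - x ^ residueFieldCard F ^ b ∈ absMaximalIdeal F) ∧
      m = (b : ℤ) - a := by
  cases m with
  | ofNat n => exact ⟨0, n, powCongr_zero_iff.mpr hσ, by simp⟩
  | negSucc n => exact ⟨n + 1, 0, powCongr_succ_zero_iff.mpr hσ, by simp [Int.negSucc_eq]⟩

/-- Conversely, "`PowCongr σ a b`" gives `IsFrobPow σ (b - a)` (shift down by `min a b`).
[folklore] -/
theorem isFrobPow_of_powCongr {σ : absoluteGaloisGroup F} {a b : ℕ}
    (h : ∀ x : absIntegers 𝒪[F] F,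
      (σ • x) ^ residueFieldCard F ^ a - x ^ residueFieldCard F ^ b ∈ absMaximalIdeal F) :
    IsFrobPow σ ((b : ℤ) - a) := by
  rcases le_or_gt a b with hab | hab
  · obtain ⟨k, rfl⟩ := Nat.exists_eq_add_of_le hab
    have h' : ∀ x : absIntegers 𝒪[F] F,
        (σ • x) ^ residueFieldCard F ^ (0 + a) - x ^ residueFieldCard F ^ (k + a) ∈
          absMaximalIdeal F := by
      rwa [zero_add, add_comm]
    have := powCongr_zero_iff.mp (powCongr_of_add_right h')
    convert this using 2
    push_cast
    ring
  · obtain ⟨k, rfl⟩ := Nat.exists_eq_add_of_lt hab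
    have h' : ∀ x : absIntegers 𝒪[F] F,
        (σ • x) ^ residueFieldCard F ^ ((k + 1) + b) - x ^ residueFieldCard F ^ (0 + b) ∈
          absMaximalIdeal F := by
      rwa [zero_add, add_comm, ← add_assoc]
    have := powCongr_succ_zero_iff.mp (powCongr_of_add_right h')
    convert this using 2
    rw [Int.negSucc_eq]
    push_cast
    ring

/-- **Discharge of the named fact `IsFrobPow.mul`**: Frobenius powers multiply and their
exponents add, i.e. `σ ↦ deg σ` is a homomorphism `W_F → ℤ`.
Ref: Tate, *Number theoretic background* (Corvallis 1979), §1.4, (1.4.1)–(1.4.4).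
[cite: Corvallis1979, (1.4.1)–(1.4.4)] -/
theorem mul_holds : IsFrobPow.mul (F := F) := by
  intro σ τ m n hσ hτ
  obtain ⟨a, b, hab, rfl⟩ := exists_powCongr hσ
  obtain ⟨c, d, hcd, rfl⟩ := exists_powCongr hτ
  have := isFrobPow_of_powCongr (powCongr_mul hab hcd)
  convert this using 2
  push_cast
  ring

end IsFrobPow

/-! ### The canonical prime `𝔓` is Galois-stable; consequences

`𝔓 = absMaximalIdeal F` is *defined* as the radical of the extended ideal `𝓂[F] S`, and both
`𝓂[F] S` and radicals are stable under every ring automorphism of `S` fixing `𝒪[F]`; so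
`σ • 𝔓 = 𝔓` for all `σ ∈ Γ_F` holds by construction (no henselian input), and with it the
normality of `I_F` and `D_𝔓 = Γ_F`.  Likewise `𝔓 ≠ ⊤` and `𝔓 ∩ 𝒪[F] = 𝓂[F]` only need
lying-over for the integral extension `S / 𝒪[F]`.
-/

namespace IsNonarchimedeanLocalField

variable (F : Type*) [Field F] [ValuativeRel F] [TopologicalSpace F] [IsNonarchimedeanLocalField F]

/-- The extended ideal `𝓂[F] S` is stable under `Γ_F` (`σ` fixes `𝒪[F]` pointwise).
Ref: Serre, *Local Fields* (1979), Ch. I §7. [folklore] -/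
theorem smul_map_maximalIdeal (σ : absoluteGaloisGroup F) :
    σ • (𝓂[F]).map (algebraMap 𝒪[F] (absIntegers 𝒪[F] F)) =
      (𝓂[F]).map (algebraMap 𝒪[F] (absIntegers 𝒪[F] F)) := by
  rw [Ideal.pointwise_smul_def, Ideal.map_map]
  congr 1
  exact RingHom.ext fun r => smul_algebraMap σ r

/-- **Discharge of `smul_absMaximalIdeal`**: `σ • 𝔓 = 𝔓` for every `σ ∈ Γ_F` (the radical of a
`Γ_F`-stable ideal is `Γ_F`-stable).
Ref: Serre, *Local Fields* (1979), Ch. II §2, Cor. 2 to Prop. 3. [cite: SerreLocalFields1979, Ch. II §2 Cor. 2 to Prop. 3] -/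
theorem smul_absMaximalIdeal_holds : smul_absMaximalIdeal F := by
  intro σ
  have hsurj : Function.Surjective
      (MulSemiringAction.toRingHom (absoluteGaloisGroup F) (absIntegers 𝒪[F] F) σ) := fun y =>
    ⟨σ⁻¹ • y, by rw [MulSemiringAction.toRingHom_apply, smul_inv_smul]⟩
  have hker : RingHom.ker
      (MulSemiringAction.toRingHom (absoluteGaloisGroup F) (absIntegers 𝒪[F] F) σ) = ⊥ :=
    (RingHom.injective_iff_ker_eq_bot _).mp (MulAction.injective σ)
  show σ • ((𝓂[F]).map (algebraMap 𝒪[F] (absIntegers 𝒪[F] F))).radical =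
    ((𝓂[F]).map (algebraMap 𝒪[F] (absIntegers 𝒪[F] F))).radical
  rw [Ideal.pointwise_smul_def, Ideal.map_radical_of_surjective hsurj (hker.trans_le bot_le),
    ← Ideal.pointwise_smul_def, smul_map_maximalIdeal]

omit [TopologicalSpace F] [IsNonarchimedeanLocalField F] in
/-- `algebraMap 𝒪[F] S` is injective (`𝒪[F] ⊆ F ⊆ F̄ ⊇ S`).
Ref: Serre, *Local Fields* (1979), Ch. II §2. [folklore] -/
theorem algebraMap_absIntegers_injective :
    Function.Injective (algebraMap 𝒪[F] (absIntegers 𝒪[F] F)) := by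
  intro r s h
  have h' := congrArg (fun x : absIntegers 𝒪[F] F => (x : AlgebraicClosure F)) h
  simp only [Subalgebra.coe_algebraMap] at h'
  rw [IsScalarTower.algebraMap_apply 𝒪[F] F (AlgebraicClosure F),
    IsScalarTower.algebraMap_apply 𝒪[F] F (AlgebraicClosure F)] at h'
  exact IsFractionRing.injective 𝒪[F] F ((algebraMap F (AlgebraicClosure F)).injective h')

/-- `𝔓 = absMaximalIdeal F` is a proper ideal (lying over: `𝓂[F] S ≠ S` for the integral
extension `S / 𝒪[F]`).
Ref: Serre, *Local Fields* (1979), Ch. II §2, Prop. 3. [folklore] -/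
theorem absMaximalIdeal_ne_top : absMaximalIdeal F ≠ ⊤ := by
  intro h
  have h1 : (𝓂[F]).map (algebraMap 𝒪[F] (absIntegers 𝒪[F] F)) = ⊤ :=
    (Ideal.radical_eq_top).mp h
  rw [Ideal.map_eq_top_iff _ (algebraMap_absIntegers_injective F)
    (fun x => Algebra.IsIntegral.isIntegral x)] at h1
  exact (IsLocalRing.maximalIdeal.isMaximal 𝒪[F]).ne_top h1

/-- **Discharge of `under_absMaximalIdeal`**: `𝔓 ∩ 𝒪[F] = 𝓂[F]` (`𝓂[F] ⊆ 𝔓 ∩ 𝒪[F] ≠ 𝒪[F]`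
and `𝓂[F]` is maximal).
Ref: Serre, *Local Fields* (1979), Ch. II §2, Prop. 3. [cite: SerreLocalFields1979, Ch. II §2 Prop. 3] -/
theorem under_absMaximalIdeal_holds : under_absMaximalIdeal F := by
  refine ((IsLocalRing.maximalIdeal.isMaximal 𝒪[F]).eq_of_le ?_ ?_).symm
  · exact Ideal.comap_ne_top _ (absMaximalIdeal_ne_top F)
  · exact Ideal.map_le_iff_le_comap.mp Ideal.le_radical

/-- **Discharge of `card_quotient_under_absMaximalIdeal`**: the exponent of Mathlib's
`IsArithFrobAt 𝒪[F] σ 𝔓` is `q_F`.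
Ref: Serre, *Local Fields* (1979), Ch. II §2. [folklore] -/
theorem card_quotient_under_absMaximalIdeal_holds : card_quotient_under_absMaximalIdeal F := by
  unfold card_quotient_under_absMaximalIdeal
  rw [show (absMaximalIdeal F).under 𝒪[F] = 𝓂[F] from under_absMaximalIdeal_holds F]
  rfl

end IsNonarchimedeanLocalField

section Consequences

open GaloisRepresentations.IsNonarchimedeanLocalField

variable (F : Type*) [Field F] [ValuativeRel F] [TopologicalSpace F] [IsNonarchimedeanLocalField F]

/-- **Discharge of `decompositionSubgroup_absMaximalIdeal_eq_top`**: `D_𝔓 = Γ_F`.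
Ref: Serre, *Local Fields* (1979), Ch. II §2, Cor. 2 to Prop. 3. [folklore] -/
theorem decompositionSubgroup_absMaximalIdeal_eq_top_holds :
    decompositionSubgroup_absMaximalIdeal_eq_top F := by
  refine (Subgroup.eq_top_iff' _).mpr fun σ => ?_
  exact Ideal.mem_decompositionSubgroup_iff.mpr (smul_absMaximalIdeal_holds F σ)

/-- **Discharge of `absInertia_normal`**: `I_F` is normal in `Γ_F` (`σ • 𝔓 = 𝔓` for all `σ`).
Ref: Serre, *Local Fields* (1979), Ch. I §7, Prop. 20; Tate, Corvallis 1979, (1.4.1). [folklore] -/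
theorem absInertia_normal_holds : absInertia_normal F := by
  refine ⟨fun σ hσ τ x => ?_⟩
  have h : τ • (σ • τ⁻¹ • x - τ⁻¹ • x) ∈ τ • absMaximalIdeal F :=
    Ideal.smul_mem_pointwise_smul _ _ _ (hσ (τ⁻¹ • x))
  rwa [smul_absMaximalIdeal_holds F τ, smul_sub, smul_inv_smul, ← mul_smul, ← mul_smul] at h

/-- **Discharge of `isClosed_absInertia`**: `I_F` is closed in `Γ_F`
(`absIntegers.isClosed_inertia_holds`).
Ref: Neukirch, *Algebraic Number Theory* (1999), Ch. IV §1. [folklore] -/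
theorem isClosed_absInertia_holds : isClosed_absInertia F :=
  absIntegers.isClosed_inertia_holds (R := 𝒪[F]) (K := F) (absMaximalIdeal F)

variable {F}

/-- **Discharge of `isAbsArithFrob_iff`** (exponent `q_F`).
Ref: Serre, *Local Fields* (1979), Ch. I §8. [folklore] -/
theorem isAbsArithFrob_iff_holds : isAbsArithFrob_iff (F := F) := by
  intro σ
  rw [← card_quotient_under_absMaximalIdeal_holds F]
  rfl

/-- **Discharge of `isFrobPow_one_iff_isAbsArithFrob`**.
Ref: Tate, Corvallis 1979, (1.4.1). [folklore] -/
theorem isFrobPow_one_iff_isAbsArithFrob_holds : isFrobPow_one_iff_isAbsArithFrob (F := F) := by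
  intro σ
  rw [isAbsArithFrob_iff_holds]
  change (∀ x, _ ∈ _) ↔ _
  simp only [pow_one]

/-- **Discharge of `IsAbsArithFrob.isFrobPow`**.  Ref: Tate, Corvallis 1979, (1.4.1). [folklore] -/
theorem IsAbsArithFrob.isFrobPow_holds : IsAbsArithFrob.isFrobPow (F := F) :=
  fun h => isFrobPow_one_iff_isAbsArithFrob_holds.mpr h

/-- **Discharge of `IsFrobPow.mul_inv_mem_absInertia`**.
Ref: Tate, Corvallis 1979, (1.4.1). [folklore] -/
theorem IsFrobPow.mul_inv_mem_absInertia_holds : IsFrobPow.mul_inv_mem_absInertia (F := F) := by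
  intro σ τ n hσ hτ
  rw [← isFrobPow_zero_iff_mem_absInertia, ← add_neg_cancel n]
  exact IsFrobPow.mul_holds hσ hτ.inv

/-- **Discharge of `IsFrobPow.inertia_mul`**.  Ref: Tate, Corvallis 1979, (1.4.1). [folklore] -/
theorem IsFrobPow.inertia_mul_holds : IsFrobPow.inertia_mul (F := F) := by
  intro σ τ n hτ hσ
  simpa using IsFrobPow.mul_holds (isFrobPow_zero_iff_mem_absInertia.mpr hτ) hσ

end Consequences

/-! ### Uniqueness of the Frobenius exponent (`IsFrobPow.unique`)

If `σ` were a Frobenius power of two different exponents, then `x ^ Q ≡ x (mod 𝔓)` for all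
`x ∈ S` with `Q = q ^ k ≥ 2` (Frobenius injectivity modulo `𝔓`, as above).  Take a prime
`ℓ > Q + p`; then `ℓ ≠ p`, so `F̄` contains a primitive `ℓ`-th root of unity `ζ ∈ S`, and
`η = ζ ^ (Q - 1)` is again primitive with `η ≡ 1 (mod 𝔓)`.  Summing the geometric series,
`0 = 1 + η + ⋯ + η ^ (ℓ - 1) ≡ ℓ (mod 𝔓)`, so `ℓ ∈ 𝔓`; with `p ∈ 𝔓` this forces `1 ∈ 𝔓`,
contradicting `𝔓 ≠ S` (lying over).  Only `𝔓` radical, `p ∈ 𝔓`, `𝔓 ≠ S` are used.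
-/

namespace IsFrobPow

open GaloisRepresentations.IsNonarchimedeanLocalField Polynomial Finset

variable {F : Type*} [Field F] [ValuativeRel F] [TopologicalSpace F] [IsNonarchimedeanLocalField F]

/-- A prime `ℓ` different from the residue characteristic is non-zero in `F`
(else `ℓ = 0` in `𝒪[F]`, hence in `𝓀[F]`, so `p ∣ ℓ`).
Ref: Serre, *Local Fields* (1979), Ch. II §1. [folklore] -/
theorem natCast_ne_zero_of_prime_ne {ℓ : ℕ} (hℓ : ℓ.Prime) (hne : ℓ ≠ ringChar 𝓀[F]) :
    (ℓ : F) ≠ 0 := by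
  classical
  intro h
  have h1 : (ℓ : 𝒪[F]) = 0 := by
    apply Subtype.ext
    simpa using h
  have h2 : (ℓ : 𝓀[F]) = 0 := by
    rw [← map_natCast (IsLocalRing.residue 𝒪[F]) ℓ, h1, map_zero]
  rw [ringChar.spec] at h2
  letI := Fintype.ofFinite 𝓀[F]
  obtain ⟨n, hp, -⟩ := FiniteField.card 𝓀[F] (ringChar 𝓀[F])
  rcases (Nat.dvd_prime hℓ).mp h2 with h3 | h3
  · exact hp.one_lt.ne' h3
  · exact hne h3.symm

/-- The key step: `x ^ (q_F ^ k) ≡ x (mod 𝔓)` for all `x ∈ S` forces `k = 0` (roots of unity of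
prime order `ℓ > q ^ k + p` survive modulo `𝔓`).
Ref: Tate, *Number theoretic background* (Corvallis 1979), (1.4.1); Serre, *Local Fields* (1979),
Ch. IV §1 (roots of unity of order prime to `p` inject into the residue field). [folklore] -/
theorem eq_zero_of_forall_pow_sub_mem {k : ℕ}
    (h : ∀ x : absIntegers 𝒪[F] F,
      x ^ residueFieldCard F ^ k - x ∈ absMaximalIdeal F) : k = 0 := by
  classical
  by_contra hk
  set Q := residueFieldCard F ^ k with hQ
  set p := ringChar 𝓀[F] with hp
  have hq1 : 1 < residueFieldCard F := one_lt_residueFieldCard F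
  have hQ2 : 2 ≤ Q := by
    have := Nat.one_lt_pow hk hq1
    omega
  -- a prime `ℓ > Q + p`
  obtain ⟨ℓ, hℓle, hℓ⟩ := Nat.exists_infinite_primes (Q + p + 1)
  letI := Fintype.ofFinite 𝓀[F]
  obtain ⟨n, hpp, -⟩ := FiniteField.card 𝓀[F] p
  have hℓp : ℓ ≠ p := by omega
  have hℓF : (ℓ : F) ≠ 0 := natCast_ne_zero_of_prime_ne hℓ hℓp
  haveI : NeZero (ℓ : F) := ⟨hℓF⟩
  -- a primitive `ℓ`-th root of unity in `S`
  obtain ⟨ζ, hζ⟩ := HasEnoughRootsOfUnity.exists_primitiveRoot (AlgebraicClosure F) ℓ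
  have hℓ0 : ℓ ≠ 0 := hℓ.ne_zero
  have hζint : IsIntegral 𝒪[F] ζ := by
    refine ⟨X ^ ℓ - 1, monic_X_pow_sub_C (1 : 𝒪[F]) hℓ0, ?_⟩
    simp [hζ.pow_eq_one]
  set z : absIntegers 𝒪[F] F := ⟨ζ, hζint⟩ with hz_def
  have hz : IsPrimitiveRoot z ℓ :=
    IsPrimitiveRoot.of_map_of_injective (f := (absIntegers 𝒪[F] F).val)
      (by simpa [hz_def] using hζ) Subtype.val_injective
  -- `η = z ^ (Q - 1)` is primitive and `η ≡ 1 (mod 𝔓)`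
  have hzu : IsUnit z := hz.isUnit hℓ.ne_zero
  have h1 : z ^ (Q - 1) - 1 ∈ absMaximalIdeal F := by
    have h2 : z * (z ^ (Q - 1) - 1) ∈ absMaximalIdeal F := by
      have h3 : z * (z ^ (Q - 1) - 1) = z ^ Q - z := by
        rw [mul_sub, mul_one, ← pow_succ']
        congr 2
        omega
      rw [h3]
      exact h z
    exact (Ideal.unit_mul_mem_iff_mem _ hzu).mp h2
  have hcop : (Q - 1).Coprime ℓ := by
    refine Nat.Coprime.symm ((Nat.Prime.coprime_iff_not_dvd hℓ).mpr fun hdvd => ?_)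
    have := Nat.le_of_dvd (by omega) hdvd
    omega
  have hη : IsPrimitiveRoot (z ^ (Q - 1)) ℓ := hz.pow_of_coprime _ hcop
  set η := z ^ (Q - 1) with hη_def
  -- `ℓ ≡ 1 + η + ⋯ + η^(ℓ-1) = 0 (mod 𝔓)`
  have hsum : ∑ i ∈ range ℓ, η ^ i = 0 := hη.geom_sum_eq_zero hℓ.one_lt
  have hℓmem : (ℓ : absIntegers 𝒪[F] F) ∈ absMaximalIdeal F := by
    have h4 : ∑ i ∈ range ℓ, (η ^ i - 1) ∈ absMaximalIdeal F := by
      refine Ideal.sum_mem _ fun i _ => ?_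
      obtain ⟨c, hc⟩ := sub_dvd_pow_sub_pow η 1 i
      rw [one_pow] at hc
      rw [hc]
      exact Ideal.mul_mem_right _ _ h1
    rw [sum_sub_distrib, hsum, sum_const, card_range, zero_sub, Ideal.neg_mem_iff,
      nsmul_eq_mul, mul_one] at h4
    exact h4
  -- `p ∈ 𝔓` too, hence `1 ∈ 𝔓`
  have hpmem : (p : absIntegers 𝒪[F] F) ∈ absMaximalIdeal F := natCast_ringChar_mem_absMaximalIdeal
  have hcop' : IsCoprime (ℓ : ℤ) (p : ℤ) :=
    Nat.isCoprime_iff_coprime.mpr ((Nat.coprime_primes hℓ hpp).mpr hℓp)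
  obtain ⟨u, v, huv⟩ := hcop'
  have hone : (1 : absIntegers 𝒪[F] F) ∈ absMaximalIdeal F := by
    have h5 : ((u * ℓ + v * p : ℤ) : absIntegers 𝒪[F] F) ∈ absMaximalIdeal F := by
      push_cast
      exact Ideal.add_mem _ (Ideal.mul_mem_left _ _ hℓmem) (Ideal.mul_mem_left _ _ hpmem)
    rwa [huv, Int.cast_one] at h5
  exact absMaximalIdeal_ne_top F ((Ideal.eq_top_iff_one _).mpr hone)

/-- `x ^ (q ^ m) ≡ x ^ (q ^ n) (mod 𝔓)` for all `x ∈ S` forces `m = n`.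
Ref: Tate, *Number theoretic background* (Corvallis 1979), (1.4.1). [folklore] -/
theorem eq_of_forall_pow_sub_pow_mem {m n : ℕ}
    (h : ∀ x : absIntegers 𝒪[F] F,
      x ^ residueFieldCard F ^ m - x ^ residueFieldCard F ^ n ∈ absMaximalIdeal F) : m = n := by
  -- reduce to `m ≤ n` by symmetry
  wlog hmn : m ≤ n generalizing m n
  · refine (this (fun x => ?_) (le_of_not_ge hmn)).symm
    rw [← Ideal.neg_mem_iff, neg_sub]
    exact h x
  obtain ⟨k, rfl⟩ := Nat.exists_eq_add_of_le hmn
  suffices hk : k = 0 by rw [hk, add_zero]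
  refine eq_zero_of_forall_pow_sub_mem (F := F) fun x => ?_
  -- `x^(q^m) - (x^(q^k))^(q^m) ∈ 𝔓`, then Frobenius injectivity
  have hx := h x
  rw [pow_add, mul_comm, pow_mul] at hx
  have := sub_mem_absMaximalIdeal_of_pow_sub_pow_mem hx
  rw [← Ideal.neg_mem_iff, neg_sub] at this
  exact this

/-- **Discharge of the named fact `IsFrobPow.unique`**: the exponent of a Frobenius power is
unique (the Frobenius `x ↦ x ^ q` has infinite order on `S ⧸ 𝔓`, witnessed by roots of unity of
order prime to `p`).  Hence `deg : W_F → ℤ` is well defined.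
Ref: Tate, *Number theoretic background* (Corvallis 1979), (1.4.1)–(1.4.4).
[cite: Corvallis1979, (1.4.1)–(1.4.4)] -/
theorem unique_holds : IsFrobPow.unique (F := F) := by
  intro σ m n hm hn
  obtain ⟨a, b, hab, rfl⟩ := exists_powCongr hm
  obtain ⟨c, d, hcd, rfl⟩ := exists_powCongr hn
  -- `(σ x)^(q^(a+c)) ≡ x^(q^(b+c))` and `≡ x^(q^(d+a))`
  have key : ∀ x : absIntegers 𝒪[F] F,
      x ^ residueFieldCard F ^ (b + c) - x ^ residueFieldCard F ^ (d + a) ∈ absMaximalIdeal F := by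
    intro x
    have h1 : ((σ • x) ^ residueFieldCard F ^ a) ^ residueFieldCard F ^ c -
        (x ^ residueFieldCard F ^ b) ^ residueFieldCard F ^ c ∈ absMaximalIdeal F :=
      pow_sub_pow_mem_absMaximalIdeal (hab x) _
    have h2 : ((σ • x) ^ residueFieldCard F ^ c) ^ residueFieldCard F ^ a -
        (x ^ residueFieldCard F ^ d) ^ residueFieldCard F ^ a ∈ absMaximalIdeal F :=
      pow_sub_pow_mem_absMaximalIdeal (hcd x) _
    have h3 : ((σ • x) ^ residueFieldCard F ^ a) ^ residueFieldCard F ^ c =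
        ((σ • x) ^ residueFieldCard F ^ c) ^ residueFieldCard F ^ a := by
      rw [← pow_mul, ← pow_mul, mul_comm]
    rw [h3] at h1
    have h4 := Ideal.sub_mem _ h2 h1
    rw [sub_sub_sub_cancel_left, ← pow_mul, ← pow_add, ← pow_mul, ← pow_add] at h4
    exact h4
  have := eq_of_forall_pow_sub_pow_mem key
  omega

end IsFrobPow

/-! ## Part II: `IsFrobPow.absGaloisRestrict` -/

/-- In `ℤᵐ⁰ = WithZero (Multiplicative ℤ)`, a nonzero element which is an `n`-th power for
unboundedly many `n` equals `1` (an integer divisible by some `n` exceeding its absolute value is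
`0`).  Auxiliary for `valuation_algebraMap_eq_one_of_sub_one_mem`. [folklore] -/
theorem WithZeroMulInt.eq_one_of_forall_exists_pow_eq {x : ℤᵐ⁰} (hx : x ≠ 0)
    (h : ∀ N : ℕ, ∃ n, N < n ∧ ∃ y : ℤᵐ⁰, y ^ n = x) : x = 1 := by
  obtain ⟨n, hNn, y, hy⟩ := h (WithZero.log x).natAbs
  have key : (n : ℤ) * WithZero.log y = WithZero.log x := by
    rw [← nsmul_eq_mul, ← WithZero.log_pow, hy]
  have h0 : WithZero.log x = 0 :=
    Int.eq_zero_of_dvd_of_natAbs_lt_natAbs (Dvd.intro _ key) (by simpa using hNn)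
  rw [← WithZero.exp_log hx, h0, WithZero.exp_zero]

namespace IsNonarchimedeanLocalField

/-! ### Residue field and Hensel's lemma for a non-archimedean local field -/

section Residue

variable {K : Type*} [Field K] [ValuativeRel K] [TopologicalSpace K] [IsNonarchimedeanLocalField K]

/-- `m ∈ 𝓂[K] ↔ v(m) < 1` for `m ∈ 𝒪[K]` (the maximal ideal of the valuation ring is the open
unit ball).  Ref: Serre, *Local Fields*, Ch. II §1. [folklore] -/
theorem mem_maximalIdeal_iff_valuation_lt_one (m : 𝒪[K]) : m ∈ 𝓂[K] ↔ valuation K m < 1 := by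
  rw [IsLocalRing.mem_maximalIdeal, mem_nonunits_iff,
    Valuation.Integer.not_isUnit_iff_valuation_lt_one]

/-- The residue cardinality `q_K = #𝓀[K]` vanishes in the residue field `𝓀[K]`.
Ref: Serre, *Local Fields*, Ch. II §1. [folklore] -/
theorem cast_residueFieldCard_eq_zero : (residueFieldCard K : 𝓀[K]) = 0 := by
  classical
  letI := Fintype.ofFinite 𝓀[K]
  rw [residueFieldCard, Nat.card_eq_fintype_card]
  exact FiniteField.cast_card_eq_zero 𝓀[K]

/-- For a unit `x` of `𝒪[K]` (`v(x) = 1`), `x ^ (q_K - 1) ≡ 1 (mod 𝓂[K])` (the residue field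
has `q_K` elements).  Ref: Serre, *Local Fields*, Ch. II §1 and Ch. IV §1. [folklore] -/
theorem pow_residueFieldCard_sub_one_sub_one_mem {x : 𝒪[K]} (hx : valuation K x = 1) :
    x ^ (residueFieldCard K - 1) - 1 ∈ 𝓂[K] := by
  classical
  letI := Fintype.ofFinite 𝓀[K]
  have hx' : IsLocalRing.residue 𝒪[K] x ≠ 0 := by
    rw [Ne, IsLocalRing.residue_eq_zero_iff, mem_maximalIdeal_iff_valuation_lt_one, hx]
    exact lt_irrefl 1
  rw [← IsLocalRing.residue_eq_zero_iff, map_sub, map_one, map_pow, residueFieldCard,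
    Nat.card_eq_fintype_card, FiniteField.pow_card_sub_one_eq_one _ hx', sub_self]

/-- Hensel's lemma for `X ^ n - u`: if `n` is invertible in the residue field `𝓀[K]` and
`u ≡ 1 (mod 𝓂[K])`, then `u = z ^ n` for some `z ≡ 1 (mod 𝓂[K])` (the local field `K` is
complete, so `𝒪[K]` is `𝓂[K]`-adically complete, hence henselian: Mathlib's
`IsAdicComplete.henselianRing`).
Ref: Serre, *Local Fields*, Ch. II §4, Prop. 7; Cassels–Fröhlich, Ch. II §10 and App. C.
[cite: SerreLocalFields1979, Ch. II §4 Prop. 7] -/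
theorem exists_pow_eq_of_sub_one_mem_maximalIdeal {n : ℕ} (hn : (n : 𝓀[K]) ≠ 0) {u : 𝒪[K]}
    (hu : u - 1 ∈ 𝓂[K]) : ∃ z : 𝒪[K], z ^ n = u ∧ z - 1 ∈ 𝓂[K] := by
  letI := IsTopologicalAddGroup.rightUniformSpace K
  haveI := isUniformAddGroup_of_addCommGroup (G := K)
  haveI : IsAdicComplete 𝓂[K] 𝒪[K] := inferInstance
  have hn0 : n ≠ 0 := by rintro rfl; exact hn Nat.cast_zero
  have h1 : Polynomial.eval 1 (Polynomial.X ^ n - Polynomial.C u) ∈ 𝓂[K] := by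
    rw [Polynomial.eval_sub, Polynomial.eval_pow, Polynomial.eval_X, Polynomial.eval_C, one_pow,
      ← Ideal.neg_mem_iff, neg_sub]
    exact hu
  have h2 : IsUnit (Ideal.Quotient.mk 𝓂[K]
      (Polynomial.eval 1 (Polynomial.derivative (Polynomial.X ^ n - Polynomial.C u)))) := by
    rw [Polynomial.derivative_sub, Polynomial.derivative_X_pow, Polynomial.derivative_C,
      sub_zero, Polynomial.eval_mul, Polynomial.eval_C, Polynomial.eval_pow,
      Polynomial.eval_X, one_pow, mul_one, map_natCast]
    change IsUnit ((n : 𝓀[K]))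
    exact isUnit_iff_ne_zero.mpr hn
  obtain ⟨a, ha, ha1⟩ := HenselianRing.is_henselian (I := 𝓂[K])
    (Polynomial.X ^ n - Polynomial.C u) (Polynomial.monic_X_pow_sub_C u hn0) 1 h1 h2
  refine ⟨a, ?_, ha1⟩
  rw [Polynomial.IsRoot, Polynomial.eval_sub, Polynomial.eval_pow, Polynomial.eval_X,
    Polynomial.eval_C, sub_eq_zero] at ha
  exact ha

end Residue

/-! ### Automatic continuity of homomorphisms between non-archimedean local fields -/

section AutomaticContinuity

variable {F E : Type*} [Field F] [ValuativeRel F] [TopologicalSpace F]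
  [IsNonarchimedeanLocalField F] [Field E] [ValuativeRel E] [TopologicalSpace E]
  [IsNonarchimedeanLocalField E] [Algebra F E]

/-- A ring homomorphism `φ : F → E` of non-archimedean local fields sends principal units
`u ≡ 1 (mod 𝓂[F])` to elements of valuation `1`: `u` is an `n`-th power in `F` for every `n ≡ 1
(mod q_F)` (Hensel), so `v_E(φ u) ∈ ℤ` is divisible by arbitrarily large integers.
Ref: the standard argument that field homomorphisms of local fields are continuous; cf.
Cassels–Fröhlich, Ch. II §10 (equivalent valuations) and Serre, *Local Fields*, Ch. II §4.
[folklore] -/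
theorem valuation_algebraMap_eq_one_of_sub_one_mem {u : 𝒪[F]} (hu : u - 1 ∈ 𝓂[F]) :
    valuation E (algebraMap F E u) = 1 := by
  have hu0 : (u : F) ≠ 0 := by
    rintro h
    have : valuation F ((u : 𝒪[F]) - 1 : 𝒪[F]) < 1 :=
      (mem_maximalIdeal_iff_valuation_lt_one _).mp hu
    simp [h] at this
  set e := _root_.IsNonarchimedeanLocalField.valueGroupWithZeroIsoInt E with he
  suffices h : e (valuation E (algebraMap F E u)) = 1 by
    rw [← map_one e] at h; exact e.injective h
  refine WithZeroMulInt.eq_one_of_forall_exists_pow_eq (by simp [hu0]) fun N => ?_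
  refine ⟨residueFieldCard F * N + 1, ?_, ?_⟩
  · have := one_lt_residueFieldCard F
    nlinarith
  · have hn : ((residueFieldCard F * N + 1 : ℕ) : 𝓀[F]) ≠ 0 := by
      simp [cast_residueFieldCard_eq_zero]
    obtain ⟨z, hz, -⟩ := exists_pow_eq_of_sub_one_mem_maximalIdeal hn hu
    refine ⟨e (valuation E (algebraMap F E z)), ?_⟩
    rw [← map_pow, ← map_pow, ← map_pow, ← SubmonoidClass.coe_pow, hz]

variable (hEF : (residueFieldCard E : 𝓀[F]) = 0)
include hEF

/-- If `q_E = 0` in `𝓀[F]` (e.g. `q_E = q_F ^ f`, `f ≥ 1`), a ring homomorphism `φ : F → E` of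
non-archimedean local fields maps principal units to principal units: `v_F(x - 1) < 1` implies
`v_E(φ x - 1) < 1` (write `x = z ^ (q_E - 1)` by Hensel; `φ z` is a unit of `𝒪[E]`, and
`w ^ (q_E - 1) ≡ 1` for every unit `w` of `𝒪[E]`).
Ref: Cassels–Fröhlich, Ch. II §10; Serre, *Local Fields*, Ch. II §4. [folklore] -/
theorem valuation_algebraMap_sub_one_lt_one {x : F} (hx : valuation F (x - 1) < 1) :
    valuation E (algebraMap F E x - 1) < 1 := by
  classical
  have hx1 : valuation F x = 1 := by
    have h := (valuation F).map_one_add_of_lt hx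
    rwa [add_sub_cancel] at h
  set u : 𝒪[F] := ⟨x, hx1.le⟩ with hu_def
  have hu : u - 1 ∈ 𝓂[F] := (mem_maximalIdeal_iff_valuation_lt_one _).mpr hx
  have hn : ((residueFieldCard E - 1 : ℕ) : 𝓀[F]) ≠ 0 := by
    rw [Nat.cast_sub (one_lt_residueFieldCard E).le, hEF, Nat.cast_one, zero_sub]
    exact neg_ne_zero.mpr one_ne_zero
  obtain ⟨z, hz, hz1⟩ := exists_pow_eq_of_sub_one_mem_maximalIdeal hn hu
  have hvz : valuation E (algebraMap F E z) = 1 := valuation_algebraMap_eq_one_of_sub_one_mem hz1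
  set w : 𝒪[E] := ⟨algebraMap F E z, hvz.le⟩ with hw_def
  have hw : w ^ (residueFieldCard E - 1) - 1 ∈ 𝓂[E] := pow_residueFieldCard_sub_one_sub_one_mem hvz
  have := (mem_maximalIdeal_iff_valuation_lt_one _).mp hw
  convert this using 2
  change algebraMap F E (u : F) - 1 = algebraMap F E z ^ (residueFieldCard E - 1) - 1
  rw [← map_pow, ← SubmonoidClass.coe_pow, hz]

/-- If `q_E = 0` in `𝓀[F]`, a ring homomorphism `F → E` of non-archimedean local fields maps
`𝓂[F]` into `𝓂[E]`: `v_F(x) < 1 → v_E(φ x) < 1` (apply the previous lemma to `1 + x`).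
Ref: Cassels–Fröhlich, Ch. II §10. [folklore] -/
theorem valuation_algebraMap_lt_one {x : F} (hx : valuation F x < 1) :
    valuation E (algebraMap F E x) < 1 := by
  have h := valuation_algebraMap_sub_one_lt_one (E := E) hEF (x := 1 + x) (by simpa using hx)
  simpa using h

/-- If `q_E = 0` in `𝓀[F]`, a ring homomorphism `F → E` of non-archimedean local fields maps units
of `𝒪[F]` to units of `𝒪[E]`: `v_F(x) = 1 → v_E(φ x) = 1` (since `x ^ (q_F - 1)` is a principal
unit and `ValueGroupWithZero E` is torsion-free).
Ref: Cassels–Fröhlich, Ch. II §10. [folklore] -/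
theorem valuation_algebraMap_eq_one {x : F} (hx : valuation F x = 1) :
    valuation E (algebraMap F E x) = 1 := by
  have hq : residueFieldCard F - 1 ≠ 0 := Nat.sub_ne_zero_of_lt (one_lt_residueFieldCard F)
  have h1 : ((⟨x, hx.le⟩ : 𝒪[F]) ^ (residueFieldCard F - 1) - 1 : 𝒪[F]) ∈ 𝓂[F] :=
    pow_residueFieldCard_sub_one_sub_one_mem hx
  have h2 : valuation F (x ^ (residueFieldCard F - 1) - 1) < 1 :=
    (mem_maximalIdeal_iff_valuation_lt_one _).mp h1
  have h3 := valuation_algebraMap_sub_one_lt_one (E := E) hEF h2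
  rw [map_pow] at h3
  have h4 : valuation E (algebraMap F E x) ^ (residueFieldCard F - 1) = 1 := by
    have h := (valuation E).map_one_add_of_lt h3
    rwa [add_sub_cancel, map_pow] at h
  exact (pow_eq_one_iff_left hq).mp h4

/-- If `q_E = 0` in `𝓀[F]`, a ring homomorphism `φ : F → E` of non-archimedean local fields
satisfies `v_E(φ x) ≤ 1 ↔ v_F(x) ≤ 1` (`φ⁻¹(𝒪[E]) = 𝒪[F]`).
Ref: Cassels–Fröhlich, Ch. II §10. [folklore] -/
theorem valuation_algebraMap_le_one_iff (x : F) :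
    valuation E (algebraMap F E x) ≤ 1 ↔ valuation F x ≤ 1 := by
  constructor
  · intro h
    by_contra hx
    rw [not_le] at hx
    have hx0 : x ≠ 0 := by rintro rfl; simp at hx
    have hinv : valuation F x⁻¹ < 1 := by
      rw [map_inv₀, inv_lt_one₀ (lt_trans zero_lt_one hx)]; exact hx
    have := valuation_algebraMap_lt_one (E := E) hEF hinv
    rw [map_inv₀, map_inv₀, inv_lt_one₀] at this
    · exact not_lt.mpr h this
    · rw [Valuation.pos_iff]; exact (map_ne_zero _).mpr hx0
  · intro h
    rcases h.lt_or_eq with h | h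
    · exact (valuation_algebraMap_lt_one hEF h).le
    · exact (valuation_algebraMap_eq_one hEF h).le

/-- If `q_E = 0` in `𝓀[F]`, a ring homomorphism `φ : F → E` of non-archimedean local fields
satisfies `v_E(φ x) < 1 ↔ v_F(x) < 1` (`φ⁻¹(𝓂[E]) = 𝓂[F]`).
Ref: Cassels–Fröhlich, Ch. II §10. [folklore] -/
theorem valuation_algebraMap_lt_one_iff (x : F) :
    valuation E (algebraMap F E x) < 1 ↔ valuation F x < 1 := by
  constructor
  · intro h
    by_contra hx
    rw [not_lt] at hx
    rcases hx.lt_or_eq with hx | hx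
    · have hx0 : x ≠ 0 := by rintro rfl; simp at hx
      have hinv : valuation F x⁻¹ < 1 := by
        rw [map_inv₀, inv_lt_one₀ (lt_trans zero_lt_one hx)]; exact hx
      have := valuation_algebraMap_lt_one (E := E) hEF hinv
      rw [map_inv₀, map_inv₀, inv_lt_one₀] at this
      · exact lt_asymm h this
      · rw [Valuation.pos_iff]; exact (map_ne_zero _).mpr hx0
    · exact h.ne (valuation_algebraMap_eq_one hEF hx.symm)
  · exact valuation_algebraMap_lt_one hEF

/-- **Automatic continuity.**  Let `F`, `E` be non-archimedean local fields and `F → E` a ring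
homomorphism (an `Algebra F E`) with `q_E = 0` in `𝓀[F]` (same residue characteristic; e.g.
`q_E = q_F ^ f` with `f ≥ 1`).  Then the valuative relation of `F` is induced from that of `E`,
i.e. `ValuativeExtension F E` holds: the homomorphism is automatically an embedding of valued
fields (and in particular continuous).
Ref: Cassels–Fröhlich, Ch. II §10 (uniqueness of complete valuations up to equivalence); Serre,
*Local Fields*, Ch. II §4. [folklore] -/
theorem valuativeExtension_of_cast_residueFieldCard_eq_zero : ValuativeExtension F E := by
  refine ⟨fun a b => ?_⟩
  rw [(valuation E).vle_iff_le, (valuation F).vle_iff_le]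
  rcases eq_or_ne b 0 with rfl | hb
  · simp
  · have hb' : valuation F b ≠ 0 := (map_ne_zero _).mpr hb
    have hb'' : valuation E (algebraMap F E b) ≠ 0 := (map_ne_zero _).mpr ((map_ne_zero _).mpr hb)
    rw [← div_le_one₀ (zero_lt_iff.mpr hb''), ← div_le_one₀ (zero_lt_iff.mpr hb'), ← map_div₀,
      ← map_div₀, ← map_div₀, valuation_algebraMap_le_one_iff hEF]

omit hEF in
/-- **Automatic continuity**, residue-cardinality form: if `q_E = q_F ^ f` for some `f : ℕ`
(necessarily `f ≥ 1` as `q_E > 1`), then any `F`-algebra structure on `E` is a valuative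
extension.  This is the form consumed by `Literature.NumberTheory.GaloisRepresentations.IsFrobPow.absGaloisRestrict_holds`.
Ref: Cassels–Fröhlich, Ch. II §10; Serre, *Local Fields*, Ch. II §4. [folklore] -/
theorem valuativeExtension_of_residueFieldCard_eq_pow {f : ℕ}
    (hf : residueFieldCard E = residueFieldCard F ^ f) : ValuativeExtension F E := by
  rcases Nat.eq_zero_or_pos f with rfl | hf0
  · rw [pow_zero] at hf
    exact absurd hf (one_lt_residueFieldCard E).ne'
  · apply valuativeExtension_of_cast_residueFieldCard_eq_zero
    rw [hf, Nat.cast_pow, cast_residueFieldCard_eq_zero, zero_pow hf0.ne']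

end AutomaticContinuity

/-! ### Spectral description of `S_K` and `𝔓_K` -/

section SpectralDescription

variable {K : Type*} [Field K] [ValuativeRel K] [TopologicalSpace K] [IsNonarchimedeanLocalField K]
variable (ε : RankLeOneStruct K)

/-- For the normed-field structure on `K` attached to a rank-one embedding
`ε : ValueGroupWithZero K →*₀ ℝ≥0` (Mathlib's `Valued.toNontriviallyNormedField` for
`Valuation.RankOne.ofRankLeOneStruct ε`), `‖x‖ = ε (v x)`.
Ref: Bosch–Güntzer–Remmert, *Non-Archimedean Analysis*, §1.5 and §3.1 (valuations vs. absolute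
values). [folklore] -/
theorem norm_eq_emb_valuation (x : K) :
    letI := IsTopologicalAddGroup.rightUniformSpace K
    letI := isUniformAddGroup_of_addCommGroup (G := K)
    letI := Valuation.RankOne.ofRankLeOneStruct ε
    letI := Valued.toNontriviallyNormedField K (ValueGroupWithZero K)
    ‖x‖ = ε.emb (valuation K x) := by
  show ((ε.emb.comp MonoidWithZeroHom.ValueGroup₀.embedding) ((valuation K).restrict x) : ℝ) = _
  simp [Valuation.embedding_restrict]

/-- For the norm attached to `ε`, `‖x‖ ≤ 1 ↔ v x ≤ 1` (`ε` is strictly monotone).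
Ref: Bosch–Güntzer–Remmert, *Non-Archimedean Analysis*, §1.5. [folklore] -/
theorem norm_le_one_iff_valuation (x : K) :
    letI := IsTopologicalAddGroup.rightUniformSpace K
    letI := isUniformAddGroup_of_addCommGroup (G := K)
    letI := Valuation.RankOne.ofRankLeOneStruct ε
    letI := Valued.toNontriviallyNormedField K (ValueGroupWithZero K)
    ‖x‖ ≤ 1 ↔ valuation K x ≤ 1 := by
  rw [norm_eq_emb_valuation, ← NNReal.coe_one, NNReal.coe_le_coe, ← map_one ε.emb,
    ε.strictMono.le_iff_le]

/-- For the norm attached to `ε`, `‖x‖ < 1 ↔ v x < 1`.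
Ref: Bosch–Güntzer–Remmert, *Non-Archimedean Analysis*, §1.5. [folklore] -/
theorem norm_lt_one_iff_valuation (x : K) :
    letI := IsTopologicalAddGroup.rightUniformSpace K
    letI := isUniformAddGroup_of_addCommGroup (G := K)
    letI := Valuation.RankOne.ofRankLeOneStruct ε
    letI := Valued.toNontriviallyNormedField K (ValueGroupWithZero K)
    ‖x‖ < 1 ↔ valuation K x < 1 := by
  rw [norm_eq_emb_valuation, ← NNReal.coe_one, NNReal.coe_lt_coe, ← map_one ε.emb,
    ε.strictMono.lt_iff_lt]

/-- An element `x` of `K̄` is integral over `𝒪[K]` iff its minimal polynomial over `K` has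
coefficients in `𝒪[K]` (`𝒪[K]` is integrally closed with fraction field `K`).
Ref: Serre, *Local Fields*, Ch. I §4 and Ch. II §2; Cassels–Fröhlich, Ch. I §4 (p. 28: "the minimal
equation of an integral element has coefficients in `R`"). [folklore] -/
theorem mem_absIntegers_iff_coeff_minpoly_mem (x : AlgebraicClosure K) :
    x ∈ absIntegers 𝒪[K] K ↔ ∀ n, (minpoly K x).coeff n ∈ 𝒪[K] := by
  rw [absIntegers, mem_integralClosure_iff]
  constructor
  · intro hx n
    rw [minpoly.isIntegrallyClosed_eq_field_fractions' K hx, Polynomial.coeff_map]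
    exact ((minpoly 𝒪[K] x).coeff n).2
  · intro h
    have hx : IsIntegral K x := Algebra.IsIntegral.isIntegral x
    have hl : minpoly K x ∈ Polynomial.lifts (algebraMap 𝒪[K] K) :=
      (Polynomial.lifts_iff_coeff_lifts _).mpr fun n => ⟨⟨_, h n⟩, rfl⟩
    obtain ⟨q, hq, -, hqm⟩ := Polynomial.lifts_and_natDegree_eq_and_monic hl (minpoly.monic hx)
    refine ⟨q, hqm, ?_⟩
    rw [← Polynomial.aeval_def, ← Polynomial.aeval_map_algebraMap K, hq, minpoly.aeval]

/-- **`S_K` is the spectral unit ball.**  For `x ∈ K̄`: `x ∈ S_K = absIntegers 𝒪[K] K` iff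
`spectralNorm K K̄ x ≤ 1` (the spectral norm is the spectral value of `minpoly K x`, which is
`≤ 1` iff all coefficients have norm `≤ 1`, Mathlib `spectralValue_le_one_iff`).
Ref: Bosch–Güntzer–Remmert, *Non-Archimedean Analysis*, 3.2.1–3.2.2; Serre, *Local Fields*,
Ch. II §2, Prop. 3. [cite: SerreLocalFields1979, Ch. II §2 Prop. 3] -/
theorem mem_absIntegers_iff_spectralNorm_le_one (x : AlgebraicClosure K) :
    letI := IsTopologicalAddGroup.rightUniformSpace K
    letI := isUniformAddGroup_of_addCommGroup (G := K)
    letI := Valuation.RankOne.ofRankLeOneStruct ε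
    letI := Valued.toNontriviallyNormedField K (ValueGroupWithZero K)
    x ∈ absIntegers 𝒪[K] K ↔ spectralNorm K (AlgebraicClosure K) x ≤ 1 := by
  letI := IsTopologicalAddGroup.rightUniformSpace K
  letI := isUniformAddGroup_of_addCommGroup (G := K)
  letI := Valuation.RankOne.ofRankLeOneStruct ε
  letI := Valued.toNontriviallyNormedField K (ValueGroupWithZero K)
  rw [mem_absIntegers_iff_coeff_minpoly_mem, spectralNorm,
    spectralValue_le_one_iff (minpoly.monic (Algebra.IsIntegral.isIntegral x))]
  simp only [norm_le_one_iff_valuation, Valuation.mem_integer_iff]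

/-- **`𝔓_K` is the spectral open unit ball.**  For `b ∈ S_K`:
`b ∈ 𝔓_K = absMaximalIdeal K = rad (𝓂[K] S_K)` iff `spectralNorm K K̄ b < 1`.  (`⊆`: elements of
`𝓂[K] S_K` have spectral norm `< 1` by the ultrametric inequality and submultiplicativity, and
the spectral norm is power-multiplicative; `⊇`: if `|b| < 1` then `|b ^ n| ≤ |m|` for a nonzero
`m ∈ 𝓂[K]` and large `n`, so `b ^ n ∈ m S_K`.)  In particular `𝔓_K` is the maximal ideal of the
valuation ring `S_K` of `K̄`.
Ref: Serre, *Local Fields*, Ch. II §2, Prop. 3 and Cor. 2; Bosch–Güntzer–Remmert 3.2.4.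
[cite: SerreLocalFields1979, Ch. II §2 Prop. 3] -/
theorem mem_absMaximalIdeal_iff_spectralNorm_lt_one (b : absIntegers 𝒪[K] K) :
    letI := IsTopologicalAddGroup.rightUniformSpace K
    letI := isUniformAddGroup_of_addCommGroup (G := K)
    letI := Valuation.RankOne.ofRankLeOneStruct ε
    letI := Valued.toNontriviallyNormedField K (ValueGroupWithZero K)
    b ∈ absMaximalIdeal K ↔ spectralNorm K (AlgebraicClosure K) b < 1 := by
  letI := IsTopologicalAddGroup.rightUniformSpace K
  letI := isUniformAddGroup_of_addCommGroup (G := K)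
  letI := Valuation.RankOne.ofRankLeOneStruct ε
  letI := Valued.toNontriviallyNormedField K (ValueGroupWithZero K)
  have alg : ∀ y : AlgebraicClosure K, IsAlgebraic K y := fun y => Algebra.IsAlgebraic.isAlgebraic y
  have hpow : ∀ (y : AlgebraicClosure K) (n : ℕ), spectralNorm K (AlgebraicClosure K) (y ^ n) =
      spectralNorm K (AlgebraicClosure K) y ^ n := by
    intro y n
    rcases n with _ | n
    · simp [spectralNorm_one]
    · exact isPowMul_spectralNorm y n.succ_pos
  have hS : ∀ c : absIntegers 𝒪[K] K, spectralNorm K (AlgebraicClosure K) c ≤ 1 := fun c =>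
    (mem_absIntegers_iff_spectralNorm_le_one ε (c : AlgebraicClosure K)).mp c.2
  -- every element of `𝓂[K] S_K` has spectral norm `< 1`
  have hmap : ∀ c ∈ 𝓂[K].map (algebraMap 𝒪[K] (absIntegers 𝒪[K] K)),
      spectralNorm K (AlgebraicClosure K) c < 1 := by
    intro c hc
    refine Submodule.span_induction
      (p := fun (c : absIntegers 𝒪[K] K) _ => spectralNorm K (AlgebraicClosure K) c < 1)
      ?_ ?_ ?_ ?_ hc
    · rintro _ ⟨m, hm, rfl⟩
      change spectralNorm K (AlgebraicClosure K) (algebraMap K (AlgebraicClosure K) m) < 1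
      rw [spectralNorm_extends, norm_lt_one_iff_valuation]
      exact (mem_maximalIdeal_iff_valuation_lt_one m).mp hm
    · simp [spectralNorm_zero]
    · intro a c _ _ ha hc
      exact lt_of_le_of_lt (isNonarchimedean_spectralNorm (a : AlgebraicClosure K) c) (max_lt ha hc)
    · intro a c _ hc
      simp only [smul_eq_mul, MulMemClass.coe_mul]
      refine lt_of_le_of_lt (spectralNorm_mul (alg _) (alg _)) ?_
      calc spectralNorm K _ (a : AlgebraicClosure K) * spectralNorm K _ (c : AlgebraicClosure K)
          ≤ 1 * spectralNorm K _ (c : AlgebraicClosure K) :=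
            mul_le_mul_of_nonneg_right (hS a) (spectralNorm_nonneg _)
        _ < 1 := by rw [one_mul]; exact hc
  constructor
  · rintro ⟨n, hn⟩
    have h := hmap _ hn
    rw [SubmonoidClass.coe_pow, hpow] at h
    contrapose! h
    exact one_le_pow₀ h
  · intro hb
    obtain ⟨m, hm0, hm1⟩ := Valuation.IsNontrivial.exists_lt_one (v := valuation K)
    have hmK : (⟨m, hm1.le⟩ : 𝒪[K]) ∈ 𝓂[K] := (mem_maximalIdeal_iff_valuation_lt_one _).mpr hm1
    have hm_pos : 0 < ‖m‖ := norm_pos_iff.mpr hm0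
    obtain ⟨n, hn⟩ := exists_pow_lt_of_lt_one hm_pos hb
    refine ⟨n, ?_⟩
    have ht : (algebraMap K (AlgebraicClosure K) m)⁻¹ * (b : AlgebraicClosure K) ^ n ∈
        absIntegers 𝒪[K] K := by
      rw [mem_absIntegers_iff_spectralNorm_le_one ε, ← map_inv₀, ← Algebra.smul_def,
        spectralNorm_smul _ (alg _), hpow, nnnorm_inv, NNReal.coe_inv, coe_nnnorm,
        inv_mul_le_iff₀ hm_pos, mul_one]
      exact hn.le
    have hbn : b ^ n = algebraMap 𝒪[K] (absIntegers 𝒪[K] K) ⟨m, hm1.le⟩ * ⟨_, ht⟩ := by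
      apply Subtype.ext
      change ((b ^ n : absIntegers 𝒪[K] K) : AlgebraicClosure K) =
        algebraMap K (AlgebraicClosure K) m * ((algebraMap K (AlgebraicClosure K) m)⁻¹ * _)
      rw [SubmonoidClass.coe_pow, ← mul_assoc, mul_inv_cancel₀ ((map_ne_zero _).mpr hm0),
        one_mul]
    rw [hbn]
    exact Ideal.mul_mem_right _ _ (Ideal.mem_map_of_mem _ hmK)

end SpectralDescription

end IsNonarchimedeanLocalField

open GaloisRepresentations.IsNonarchimedeanLocalField

/-! ### The embedding `F̄ → Ē` preserves integrality and the canonical prime -/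

section Restrict

variable (F E : Type*) [Field F] [ValuativeRel F] [TopologicalSpace F]
  [IsNonarchimedeanLocalField F] [Field E] [ValuativeRel E] [TopologicalSpace E]
  [IsNonarchimedeanLocalField E] [Algebra F E] [ValuativeExtension F E]

/-- Compatibility of the norms: with the rank-one embedding of `F` induced from `ε` through
`ValuativeExtension.mapValueGroupWithZero F E`, one has `‖algebraMap F E k‖ = ‖k‖`.
Ref: Cassels–Fröhlich, Ch. II §10 (an extension `‖·‖` of `|·|`: `‖b‖ = |b|` for `b ∈ k`).
[folklore] -/
theorem norm_algebraMap_eq (ε : RankLeOneStruct E) (k : F) :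
    letI := IsTopologicalAddGroup.rightUniformSpace E
    letI := isUniformAddGroup_of_addCommGroup (G := E)
    letI := Valuation.RankOne.ofRankLeOneStruct ε
    letI := Valued.toNontriviallyNormedField E (ValueGroupWithZero E)
    letI := IsTopologicalAddGroup.rightUniformSpace F
    letI := isUniformAddGroup_of_addCommGroup (G := F)
    letI := Valuation.RankOne.ofRankLeOneStruct
      (⟨ε.emb.comp (ValuativeExtension.mapValueGroupWithZero F E),
        ε.strictMono.comp ValuativeExtension.mapValueGroupWithZero_strictMono⟩ : RankLeOneStruct F)
    letI := Valued.toNontriviallyNormedField F (ValueGroupWithZero F)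
    ‖algebraMap F E k‖ = ‖k‖ := by
  rw [norm_eq_emb_valuation, norm_eq_emb_valuation]
  simp

/-- **Uniqueness of the extension of the absolute value** (Cassels–Fröhlich, Ch. II §10, Theorem:
a complete `k` has *precisely one* extension of `|·|` to a finite extension; Bosch–Güntzer–Remmert
3.2.4/2 for algebraic extensions, Mathlib `spectralNorm_unique`), in the form: for the chosen
`F`-embedding `ι = absClosureEmbedding F E : F̄ → Ē` and compatible norms on `F ⊆ E`,
`spectralNorm E Ē (ι a) = spectralNorm F F̄ a` for all `a ∈ F̄`.  Indeed
`a ↦ spectralNorm E Ē (ι a)` is a power-multiplicative `F`-algebra norm on `F̄`, and `F` is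
complete. [cite: CasselsFrohlichANT1967, Ch. II §10 Theorem] -/
theorem spectralNorm_absClosureEmbedding (ε : RankLeOneStruct E) (a : AlgebraicClosure F) :
    letI := IsTopologicalAddGroup.rightUniformSpace E
    letI := isUniformAddGroup_of_addCommGroup (G := E)
    letI := Valuation.RankOne.ofRankLeOneStruct ε
    letI := Valued.toNontriviallyNormedField E (ValueGroupWithZero E)
    letI := IsTopologicalAddGroup.rightUniformSpace F
    letI := isUniformAddGroup_of_addCommGroup (G := F)
    letI := Valuation.RankOne.ofRankLeOneStruct
      (⟨ε.emb.comp (ValuativeExtension.mapValueGroupWithZero F E),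
        ε.strictMono.comp ValuativeExtension.mapValueGroupWithZero_strictMono⟩ : RankLeOneStruct F)
    letI := Valued.toNontriviallyNormedField F (ValueGroupWithZero F)
    spectralNorm E (AlgebraicClosure E) (absClosureEmbedding F E a) =
      spectralNorm F (AlgebraicClosure F) a := by
  letI := IsTopologicalAddGroup.rightUniformSpace E
  letI := isUniformAddGroup_of_addCommGroup (G := E)
  letI := Valuation.RankOne.ofRankLeOneStruct ε
  letI := Valued.toNontriviallyNormedField E (ValueGroupWithZero E)
  letI := IsTopologicalAddGroup.rightUniformSpace F
  letI := isUniformAddGroup_of_addCommGroup (G := F)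
  letI := Valuation.RankOne.ofRankLeOneStruct
    (⟨ε.emb.comp (ValuativeExtension.mapValueGroupWithZero F E),
      ε.strictMono.comp ValuativeExtension.mapValueGroupWithZero_strictMono⟩ : RankLeOneStruct F)
  letI := Valued.toNontriviallyNormedField F (ValueGroupWithZero F)
  set ι := absClosureEmbedding F E with hι
  -- the pulled-back spectral norm of `Ē` is a power-multiplicative `F`-algebra norm on `F̄`
  let g : AlgebraNorm F (AlgebraicClosure F) :=
    { toFun := fun a => spectralAlgNorm E (AlgebraicClosure E) (ι a)
      map_zero' := by simp only [map_zero]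
      add_le' := fun a b => by simp only [map_add]; exact map_add_le_add _ _ _
      neg' := fun a => by simp only [map_neg]; exact map_neg_eq_map _ _
      mul_le' := fun a b => by simp only [map_mul]; exact map_mul_le_mul _ _ _
      eq_zero_of_map_eq_zero' := fun a ha => by
        simpa only [map_eq_zero_iff_eq_zero, map_eq_zero] using ha
      smul' := fun k a => by
        simp only [map_smul]
        rw [← algebraMap_smul E k (ι a), map_smul_eq_mul, norm_algebraMap_eq] }
  have hg : IsPowMul g := fun a n hn => by
    change spectralNorm E _ (ι (a ^ n)) = spectralNorm E _ (ι a) ^ n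
    rw [map_pow, isPowMul_spectralNorm _ hn]
  have := spectralNorm_unique hg
  exact congrArg (fun f : AlgebraNorm F (AlgebraicClosure F) => f a) this

variable {F E} in
/-- The embedding `ι : F̄ → Ē` identifies the absolute integers: `ι a ∈ S_E ↔ a ∈ S_F`
(both sides mean spectral norm `≤ 1`, and the spectral norms agree).
Ref: Serre, *Local Fields*, Ch. II §2, Prop. 3; Cassels–Fröhlich, Ch. II §10.
[cite: CasselsFrohlichANT1967, Ch. II §10 Theorem] -/
theorem absClosureEmbedding_mem_absIntegers_iff (a : AlgebraicClosure F) :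
    absClosureEmbedding F E a ∈ absIntegers 𝒪[E] E ↔ a ∈ absIntegers 𝒪[F] F := by
  obtain ⟨ε⟩ := IsRankLeOne.nonempty (R := E)
  rw [mem_absIntegers_iff_spectralNorm_le_one ε, spectralNorm_absClosureEmbedding,
    ← mem_absIntegers_iff_spectralNorm_le_one]

variable {F E} in
/-- The embedding `ι : F̄ → Ē` identifies the canonical primes: for `a ∈ S_F`,
`ι a ∈ 𝔓_E ↔ a ∈ 𝔓_F` (both sides mean spectral norm `< 1`).  In other words
`𝔓_F = ι⁻¹(𝔓_E) ∩ S_F`.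
Ref: Serre, *Local Fields*, Ch. II §2, Cor. 2 to Prop. 3; Cassels–Fröhlich, Ch. II §10.
[cite: CasselsFrohlichANT1967, Ch. II §10 Theorem] -/
theorem absClosureEmbedding_mem_absMaximalIdeal_iff (a : absIntegers 𝒪[F] F)
    (ha : absClosureEmbedding F E a ∈ absIntegers 𝒪[E] E) :
    (⟨absClosureEmbedding F E a, ha⟩ : absIntegers 𝒪[E] E) ∈ absMaximalIdeal E ↔
      a ∈ absMaximalIdeal F := by
  obtain ⟨ε⟩ := IsRankLeOne.nonempty (R := E)
  rw [mem_absMaximalIdeal_iff_spectralNorm_lt_one ε, spectralNorm_absClosureEmbedding,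
    ← mem_absMaximalIdeal_iff_spectralNorm_lt_one]

variable {E} in
/-- Degree scaling under restriction, elementwise form: if `τ ∈ Gal(Ē/E)` satisfies
`τ • x ≡ x ^ (q_E ^ k) (mod 𝔓_E)` on `S_E` and `q_E = q_F ^ f`, then
`res τ • y ≡ y ^ (q_F ^ (f k)) (mod 𝔓_F)` on `S_F`: apply `ι`, use
`ι (res τ • y) = τ • ι y` (`absGaloisRestrict_apply_smul`) and `𝔓_F = ι⁻¹(𝔓_E) ∩ S_F`.
Ref: Tate, *Number theoretic background* (Corvallis 1979), (1.4.5)–(1.4.6).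
[cite: Corvallis1979, §1.4 (1.4.5)–(1.4.6)] -/
theorem isFrobPow_absGaloisRestrict_of_forall (τ : absoluteGaloisGroup E) (k f : ℕ)
    (hf : residueFieldCard E = residueFieldCard F ^ f)
    (hτ : ∀ x : absIntegers 𝒪[E] E, τ • x - x ^ residueFieldCard E ^ k ∈ absMaximalIdeal E)
    (y : absIntegers 𝒪[F] F) :
    Literature.NumberTheory.GaloisRepresentations.absGaloisRestrict F E τ • y - y ^ residueFieldCard F ^ (f * k) ∈ absMaximalIdeal F := by
  set ι := absClosureEmbedding F E with hι
  have hy : ι y ∈ absIntegers 𝒪[E] E := (absClosureEmbedding_mem_absIntegers_iff _).mpr y.2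
  set z : absIntegers 𝒪[F] F := Literature.NumberTheory.GaloisRepresentations.absGaloisRestrict F E τ • y - y ^ residueFieldCard F ^ (f * k)
  have hz : ι z ∈ absIntegers 𝒪[E] E := (absClosureEmbedding_mem_absIntegers_iff _).mpr z.2
  rw [← absClosureEmbedding_mem_absMaximalIdeal_iff z hz]
  convert hτ ⟨ι y, hy⟩ using 1
  apply Subtype.ext
  simp [z, ι, integralClosure.coe_smul, absGaloisRestrict_apply_smul, hf, pow_mul]

end Restrict

/-! ### Discharge of `Literature.NumberTheory.GaloisRepresentations.IsFrobPow.absGaloisRestrict` -/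

section Holds

variable (F : Type*) {E : Type*} [Field F] [ValuativeRel F] [TopologicalSpace F]
  [IsNonarchimedeanLocalField F] [Field E] [ValuativeRel E] [TopologicalSpace E]
  [IsNonarchimedeanLocalField E] [Algebra F E]

/-- **Discharge of `Literature.NumberTheory.GaloisRepresentations.IsFrobPow.absGaloisRestrict`** (degree scaling under restriction): if
`σ ∈ Gal(Ē/E)` is a Frobenius power of exponent `n` for `E` and `q_E = q_F ^ f`, then
`Literature.absGaloisRestrict F E σ` is a Frobenius power of exponent `f n` for `F` — Tate's
`W_E = Gal(Ē/E) ∩ W_F` with `‖w‖_E = ‖w‖_F`.  As registered the fact assumes only an `F`-algebra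
structure on `E`; the compatibility of the valuations is automatic
(`valuativeExtension_of_residueFieldCard_eq_pow`), after which the elementwise statement is
`isFrobPow_absGaloisRestrict_of_forall` (negative exponents through `σ⁻¹` and
`isFrobPow_neg_natCast_iff`).
Ref: Tate, *Number theoretic background* (Corvallis 1979), §1.4, (1.4.5)–(1.4.6); Serre, *Local
Fields*, Ch. I §8 and Ch. II §2. [cite: Corvallis1979, §1.4 (1.4.5)–(1.4.6)] -/
theorem IsFrobPow.absGaloisRestrict_holds : IsFrobPow.absGaloisRestrict F (E := E) := by
  intro σ n hσ f hf
  haveI : ValuativeExtension F E := valuativeExtension_of_residueFieldCard_eq_pow hf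
  obtain ⟨k⟩ | ⟨k⟩ := n
  · rw [Int.ofNat_eq_natCast, ← Nat.cast_mul, isFrobPow_natCast_iff]
    exact isFrobPow_absGaloisRestrict_of_forall F σ k f hf (isFrobPow_natCast_iff.mp hσ)
  · have h : (f : ℤ) * Int.negSucc k = -((f * (k + 1) : ℕ) : ℤ) := by
      rw [Int.negSucc_eq]; push_cast; ring
    rw [h, isFrobPow_neg_natCast_iff, ← map_inv, isFrobPow_natCast_iff]
    exact isFrobPow_absGaloisRestrict_of_forall F σ⁻¹ (k + 1) f hf (isFrobPow_negSucc_iff.mp hσ)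

end Holds

end Literature.NumberTheory.GaloisRepresentations
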